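import Mathlib
import Literature.Combinatorics.SimpleGraph.HypercubeSpectrum
import Literature.Combinatorics.SimpleGraph.LaplacianSpectrumSpanningTrees
import HarnessLib

/-!
# The number of spanning trees of the hypercube: `T(Q_n) = 2^{−n} ∏_{i=1}^{n} (2i)^{C(n,i)}`
# (Bernardi 2012, eq. (1))

Source (held, read at the page; VERBATIM). O. Bernardi, *On the spanning trees of the hypercube
and other products of graphs*, Electron. J. Combin. 19(4) (2012) P51 [Bernardi2012] (held text
`paper:arxiv-1207.0896` p0003), §1: «Let `C_n` be the hypercube in dimension `n`. The vertex set
of `C_n` is `{0,1}^n`, and two vertices are adjacent if they differ on one coordinate. It is known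
that the number of spanning trees of `C_n` is `T(C_n) = (1/2^n) ∏_{i=1}^{n} (2i)^{(n choose i)}`.
(1) This formula can be obtained by using the matrix-tree theorem and then determining the
eigenvalues of the Laplacian of the hypercube. This, in turns, can be done either using the
representation theory of Abelian groups (applied to the group `(ℤ/2ℤ)^n`) [Stanley, EC2], or by
guessing and checking a set of eigenvectors [Martin–Reiner].»

What is filed (theorems only) — exactly the route the source names: the Matrix-Tree Theorem in
spectral form (`|V|·T(G)` = the product of the Laplace eigenvalues with one zero removed, the
tree's `LaplacianSpectrumSpanningTrees.card_mul_card_spanningTrees_eq_prod_erase`, Merris (65) /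
Brouwer–Haemers Prop. 1.3.4) fed with the Laplace spectrum of the hypercube (`2i` with
multiplicity `C(n, i)`, the tree's `HypercubeSpectrum.map_eigenvalues_lapMatrix_hypercube`).
`Q_n` is the tree's `BakerNorine.hypercube n` on `Fin n → Bool`; `T(G)` is written
`Nat.card {T // T ≤ G ∧ T.IsTree}` as in the tree's spanning-tree files.
* **`two_pow_mul_card_spanningTrees_hypercube`** — `2^n · T(Q_n) = ∏_{i=1}^{n} (2i)^{C(n,i)}`
  (over `ℝ`), **`card_spanningTrees_hypercube`** — eq. (1) as printed,
  `two_pow_mul_card_spanningTrees_hypercube_nat` — the same identity in `ℕ`.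
NOT CLAIMED: Bernardi's combinatorial proofs, the refined generating functions (2)–(3) and the
formulas for products of complete graphs.
-/

namespace Literature.Combinatorics.SimpleGraph.HypercubeSpanningTrees

open Finset Matrix
open BakerNorine (hypercube weight weight_apply)
open HypercubeSpectrum (map_eigenvalues_lapMatrix_hypercube card_filter_weight_eq)
open LaplacianSpectrumSpanningTrees (card_mul_card_spanningTrees_eq_prod_erase)

/-- The only weight-`0` vector is `0`. [folklore] -/
private theorem weight_eq_zero_iff {n : ℕ} (w : Fin n → Bool) :
    weight w = 0 ↔ w = fun _ => false := by
  rw [weight_apply, Finset.card_eq_zero, Finset.filter_eq_empty_iff]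
  constructor
  · intro h
    funext i
    have := h (mem_univ i)
    simpa using this
  · rintro rfl i -
    simp

/-- The Hamming weight is at most the length. [folklore] -/
private theorem weight_le {n : ℕ} (w : Fin n → Bool) : weight w ≤ n := by
  rw [weight_apply]
  exact (Finset.card_filter_le _ _).trans (by rw [Finset.card_univ, Fintype.card_fin])

/-- Regrouping the product of `2·wt(w)` over the nonzero vectors by weight. [folklore] -/
private theorem prod_erase_zero_eq (n : ℕ) :
    ∏ w ∈ (univ : Finset (Fin n → Bool)).erase (fun _ => false), (2 * (weight w : ℝ))
      = ∏ i ∈ Icc 1 n, (2 * (i : ℝ)) ^ n.choose i := by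
  rw [← Finset.prod_fiberwise_of_maps_to (s := univ.erase fun _ => false) (t := Icc 1 n)
    (g := fun w => weight w) (fun w hw => by
      rw [mem_Icc]
      refine ⟨Nat.one_le_iff_ne_zero.2 fun h => (mem_erase.1 hw).1 ((weight_eq_zero_iff w).1 h),
        weight_le w⟩)]
  refine Finset.prod_congr rfl fun i hi => ?_
  have hi1 : 1 ≤ i := (mem_Icc.1 hi).1
  have hfib : (univ.erase fun _ : Fin n => false).filter (fun w => weight w = i)
      = univ.filter fun w : Fin n → Bool => weight w = i := by
    ext w
    rw [mem_filter, mem_filter, mem_erase]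
    constructor
    · exact fun h => ⟨mem_univ _, h.2⟩
    · intro hw
      refine ⟨⟨fun h0 => ?_, mem_univ _⟩, hw.2⟩
      have hw2 := hw.2
      rw [(weight_eq_zero_iff w).2 h0] at hw2
      omega
  rw [hfib, Finset.prod_congr rfl (fun w hw => by rw [(mem_filter.1 hw).2] : ∀ w ∈ univ.filter
    (fun w : Fin n → Bool => weight w = i), 2 * (weight w : ℝ) = 2 * (i : ℝ)), Finset.prod_const,
    card_filter_weight_eq]

/-- **`2^n · T(Q_n) = ∏_{i=1}^{n} (2i)^{C(n,i)}`** — the Matrix-Tree Theorem in spectral form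
(`|V| · T(G)` = product of the nonzero Laplace eigenvalues, the tree's
`LaplacianSpectrumSpanningTrees.card_mul_card_spanningTrees_eq_prod_erase`) fed with the Laplace
spectrum of the hypercube (`2i` with multiplicity `C(n, i)`, the tree's
`HypercubeSpectrum.map_eigenvalues_lapMatrix_hypercube`): «This formula can be obtained by using
the matrix-tree theorem and then determining the eigenvalues of the Laplacian of the hypercube.»
[cite: Bernardi2012, §1 eq. (1) (arXiv p. 1)] -/
theorem two_pow_mul_card_spanningTrees_hypercube (n : ℕ) [DecidableRel (hypercube n).Adj] :
    (2 : ℝ) ^ n * (Nat.card {T : SimpleGraph (Fin n → Bool) // T ≤ hypercube n ∧ T.IsTree} : ℝ)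
      = ∏ i ∈ Icc 1 n, (2 * (i : ℝ)) ^ n.choose i := by
  have hL : ((hypercube n).lapMatrix ℝ).IsHermitian := SimpleGraph.isHermitian_lapMatrix _ _
  have h := card_mul_card_spanningTrees_eq_prod_erase (hypercube n) hL
  rw [map_eigenvalues_lapMatrix_hypercube n hL] at h
  have hcard : (Fintype.card (Fin n → Bool) : ℝ) = 2 ^ n := by simp
  -- removing the one zero eigenvalue = removing the zero vector
  have hm : ((univ : Finset (Fin n → Bool)).val.map (fun w => 2 * (weight w : ℝ))).erase 0
      = ((univ : Finset (Fin n → Bool)).erase (fun _ => false)).val.map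
          (fun w => 2 * (weight w : ℝ)) := by
    rw [Finset.erase_val, Multiset.map_erase_of_mem _ _ (Finset.mem_univ _),
      (weight_eq_zero_iff _).2 rfl]
    simp
  rw [hcard, hm, ← Finset.prod_eq_multiset_prod] at h
  rw [h]
  exact prod_erase_zero_eq n

/-- **BERNARDI 2012, eq. (1): «Let `C_n` be the hypercube in dimension `n`. The vertex set of `C_n`
is `{0,1}^n`, and two vertices are adjacent if they differ on one coordinate. It is known that the
number of spanning trees of `C_n` is `T(C_n) = (1/2^n) ∏_{i=1}^{n} (2i)^{C(n,i)}`.»**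
[cite: Bernardi2012, §1 eq. (1) (arXiv p. 1)] -/
theorem card_spanningTrees_hypercube (n : ℕ) [DecidableRel (hypercube n).Adj] :
    (Nat.card {T : SimpleGraph (Fin n → Bool) // T ≤ hypercube n ∧ T.IsTree} : ℝ)
      = (∏ i ∈ Icc 1 n, (2 * (i : ℝ)) ^ n.choose i) / 2 ^ n := by
  rw [← two_pow_mul_card_spanningTrees_hypercube n,
    mul_div_cancel_left₀ _ (pow_ne_zero _ two_ne_zero)]

/-- The same count in natural numbers: `2^n · T(Q_n) = ∏_{i=1}^{n} (2i)^{C(n,i)}`.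
[cite: Bernardi2012, §1 eq. (1)] -/
theorem two_pow_mul_card_spanningTrees_hypercube_nat (n : ℕ) [DecidableRel (hypercube n).Adj] :
    2 ^ n * Nat.card {T : SimpleGraph (Fin n → Bool) // T ≤ hypercube n ∧ T.IsTree}
      = ∏ i ∈ Icc 1 n, (2 * i) ^ n.choose i := by
  have h := two_pow_mul_card_spanningTrees_hypercube n
  exact_mod_cast h

end Literature.Combinatorics.SimpleGraph.HypercubeSpanningTrees
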